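import Summits.CriticalPhenomena.PercolationContinuityZ3.Theorems.Transplant.AutEndStateTypesDefs
import Summits.CriticalPhenomena.PercolationContinuityZ3.Theorems.Transplant.AutChartCriticalContinuity
import Summits.CriticalPhenomena.PercolationContinuityZ3.Theorems.Transplant.CayleySkeletonSign
import Summits.CriticalPhenomena.PercolationContinuityZ3.Theorems.Transplant.CayleyMilnorKernel
import HarnessLib

/-!
# The type number is a property of the CAYLEY GRAPH, not of the group: on a Cayley graph of `Γ_p = ℤ^p ⋊ C_p` whose alphabet is invariant under conjugation
# by the rotations, ONE type suffices — `θ(p_c) = 0` modulo the one-type node `U_s` — although a GRR of the same group needs `p` types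

builds on p205010 (kernel theorem, internal audit signed; external expert review pending) — nothing in this file uses p205010.  CONDITIONAL on the OPEN one-type scaled
node `SamePDropOfSkeletonFrmScaled₁` (hypothesis `hN`; nothing is claimed about it).  Lane `prim-bschramm`, seat `prim-bschramm-p4` gen 28 (PART C3 of `P4-GENERAL.md`
§50.8).  Helper file (`--supports stmt-CriticalPhenomena-4575 --as helper`); def-free (the automorphisms and the subgroup are assembled inside the proofs).

Companion of `AutEndStateTypes` (`ZWr.le_card_reps_of_grr`: on a GRR of `Γ_p` every end-state datum has `≥ p` types).  If the finite alphabet `S ⊆ Γ_p` is invariant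
under conjugation by the rotations `inr h` (e.g. `S = {e_i : i ∈ ℤ/p} ∪ {ρ}`: all basis vectors of `ℤ^p` and the rotation), then RIGHT multiplication by `inr h` is an
automorphism of `Cay(Γ_p; S)` as well, and the ABELIAN group `ℤ^p × C_p` of automorphisms `x ↦ inl v · x · inr h` acts TRANSITIVELY (indeed freely) and TRANSLATES
the rank-two chart `x ↦ (x.left 0, x.left 1)` — the input of gen 25's `AutChart.criticalContinuity_of_autSubgroup`:
* `ZWr.left_mul_inr` — right multiplication by a rotation does not change the lattice part;
* **`ZWr.criticalContinuity_of_conjInvariant`** — `U_s` ⟹ `θ_x(p_c) = 0` at every vertex of every such `Cay(Γ_p; S)`, `p` prime (so `p ≥ 2`).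
So the SAME wall group (`b₁(Γ_p) = 1`) has Cayley graphs in the ONE-type class (symmetric alphabets: `Aut ⊋ Γ_p` contains an abelian transitive group with `b₁ = p`)
and Cayley graphs needing `p` types (GRRs): INPUT(G) and the type number are invariants of `Aut(Cay(Γ; S))`, not of `Γ` (P4 §40/§48 made concrete in one family).
[cite: BenjaminiSchramm1996, Conj. 4; §2 (Cayley graphs)] [cite: KozmaNitzan2024, §4 p. 16 (Lemma 8: the role of the lattice symmetries)]
-/

noncomputable section

namespace Summit.CriticalPhenomena.PercolationContinuityZ3.Theorems.Transplant

open SimpleGraph Literature.Probability.LatticeModels Literature.Probability.Percolation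
open scoped Classical

namespace ZWr

variable {p : ℕ}

/-- **Right multiplication by a rotation does not change the lattice part** (`(inr h).left = 1`). [folklore] -/
theorem left_mul_inr (x : Grp p) (h : Rot p) : (x * SemidirectProduct.inr h).left = x.left := by
  rw [SemidirectProduct.mul_left, SemidirectProduct.left_inr, map_one, mul_one]

/-- Left multiplication by a lattice vector adds it to the lattice part (`(inl v).right = 1` acts trivially). [folklore] -/
theorem left_inl_mul (v : Lat p) (x : Grp p) : (SemidirectProduct.inl v * x).left = v * x.left := by
  rw [SemidirectProduct.mul_left, SemidirectProduct.left_inl, SemidirectProduct.right_inl, map_one, MulAut.one_apply]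

/-- **THEOREM (one type suffices on rotation-invariant alphabets, modulo `U_s`).**  `p` prime, `S ⊆ Γ_p = ℤ^p ⋊ C_p` a finite generating set invariant under
conjugation by every rotation `inr h`.  Then `θ_x(p_c) = 0` at every vertex of `Cay(Γ_p; S)`, modulo the one-type scaled node `SamePDropOfSkeletonFrmScaled₁` alone:
the automorphisms `x ↦ inl v · x · inr h` (`v ∈ ℤ^p`, `h ∈ C_p`) form a transitive group translating the rank-two chart `x ↦ (x.left 0, x.left 1)`
(`AutChart.criticalContinuity_of_autSubgroup`). [cite: BenjaminiSchramm1996, Conj. 4; §2 (Cayley graphs)] [cite: KozmaNitzan2024, §4 p. 16 (Lemma 8)] -/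
theorem criticalContinuity_of_conjInvariant [Fact p.Prime] (hN : SamePDropOfSkeletonFrmScaled₁) (S : Finset (Grp p))
    (hS : Subgroup.closure (S : Set (Grp p)) = ⊤)
    (hinv : ∀ (h : Rot p) (s : Grp p), s ∈ S → SemidirectProduct.inr h * s * (SemidirectProduct.inr h)⁻¹ ∈ S) (x : Grp p) :
    theta (mulCayley (↑S : Set (Grp p))) x (criticalProbIOf (mulCayley (↑S : Set (Grp p))) x) = 0 := by
  haveI : NeZero p := ⟨(Fact.out : p.Prime).ne_zero⟩
  -- the chart
  let φ : Grp p → Site 2 := fun y => ![Multiplicative.toAdd y.left 0, Multiplicative.toAdd y.left 1]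
  have hφ0 : ∀ y : Grp p, φ y 0 = Multiplicative.toAdd y.left 0 := fun y => rfl
  have hφ1 : ∀ y : Grp p, φ y 1 = Multiplicative.toAdd y.left 1 := fun y => rfl
  -- conjugation by a rotation preserves `S` (both directions)
  have hσ : ∀ (h : Rot p) (s : Grp p), MulAut.conj (SemidirectProduct.inr h) s ∈ S ↔ s ∈ S := by
    intro h s
    rw [MulAut.conj_apply]
    refine ⟨fun hs => ?_, hinv h s⟩
    have h2 := hinv h⁻¹ _ hs
    rwa [map_inv, inv_inv, ← mul_assoc, ← mul_assoc, inv_mul_cancel, one_mul, mul_assoc, inv_mul_cancel, mul_one] at h2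
  -- right multiplication by `inr h`, as an automorphism: `L_{inr h} ∘ conj_{(inr h)⁻¹}`
  let R : Rot p → (mulCayley (↑S : Set (Grp p)) ≃g mulCayley (↑S : Set (Grp p))) := fun h =>
    leftMulIso S (SemidirectProduct.inr h) * autOfMulEquiv S (MulAut.conj (SemidirectProduct.inr h⁻¹)) (hσ h⁻¹)
  have hR : ∀ (h : Rot p) (y : Grp p), R h y = y * SemidirectProduct.inr h := by
    intro h y
    show SemidirectProduct.inr h * (MulAut.conj (SemidirectProduct.inr h⁻¹)) y = y * SemidirectProduct.inr h
    rw [MulAut.conj_apply, map_inv, inv_inv, ← mul_assoc, ← mul_assoc, mul_inv_cancel, one_mul]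
  let L : Lat p → (mulCayley (↑S : Set (Grp p)) ≃g mulCayley (↑S : Set (Grp p))) := fun v => leftMulIso S (SemidirectProduct.inl v)
  have hL : ∀ (v : Lat p) (y : Grp p), L v y = SemidirectProduct.inl v * y := fun v y => rfl
  -- the translating group
  let A : Subgroup (mulCayley (↑S : Set (Grp p)) ≃g mulCayley (↑S : Set (Grp p))) := Subgroup.closure (Set.range L ∪ Set.range R)
  have htrans : ∀ α ∈ A, ∃ d : Site 2, ∀ w : Grp p, φ (α w) = φ w + d := by
    intro α hα
    induction hα using Subgroup.closure_induction with
    | mem β hβ =>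
      rcases hβ with ⟨v, rfl⟩ | ⟨h, rfl⟩
      · refine ⟨![Multiplicative.toAdd v 0, Multiplicative.toAdd v 1], fun w => ?_⟩
        funext i
        rw [hL, Pi.add_apply]
        fin_cases i
        · show φ _ 0 = φ w 0 + Multiplicative.toAdd v 0
          rw [hφ0, hφ0, left_inl_mul, toAdd_mul, Pi.add_apply, add_comm]
        · show φ _ 1 = φ w 1 + Multiplicative.toAdd v 1
          rw [hφ1, hφ1, left_inl_mul, toAdd_mul, Pi.add_apply, add_comm]
      · refine ⟨0, fun w => ?_⟩
        funext i
        rw [hR, Pi.add_apply, Pi.zero_apply, add_zero]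
        fin_cases i
        · show φ _ 0 = φ w 0
          rw [hφ0, hφ0, left_mul_inr]
        · show φ _ 1 = φ w 1
          rw [hφ1, hφ1, left_mul_inr]
    | one => exact ⟨0, fun w => by rw [add_zero]; rfl⟩
    | mul β γ _ _ hβ hγ =>
      obtain ⟨d, hd⟩ := hβ
      obtain ⟨d', hd'⟩ := hγ
      refine ⟨d' + d, fun w => ?_⟩
      rw [RelIso.coe_mul, Function.comp_apply, hd, hd', add_assoc]
    | inv β _ hβ =>
      obtain ⟨d, hd⟩ := hβ
      refine ⟨-d, fun w => ?_⟩
      have h1 := hd (β⁻¹ w)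
      rw [show β (β⁻¹ w) = w from RelIso.apply_inv_self β w] at h1
      rw [h1]; abel
  have hconn : (mulCayley (↑S : Set (Grp p))).Connected := CayleyScaled.connected_mulCayley_of_closure S hS
  refine AutChart.criticalContinuity_of_autSubgroup hN hconn 1 A ?_ φ ?_ ?_ x
  · -- transitivity: `y = inl y.left · 1 · inr y.right`
    intro y
    refine ⟨L y.left * R y.right, A.mul_mem (Subgroup.subset_closure (Or.inl ⟨y.left, rfl⟩)) (Subgroup.subset_closure (Or.inr ⟨y.right, rfl⟩)), ?_⟩
    rw [RelIso.coe_mul, Function.comp_apply, hR, hL, one_mul, ← SemidirectProduct.mk_eq_inl_mul_inr]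
  · intro α hα w
    obtain ⟨d, hd⟩ := htrans α hα
    rw [hd, hd, add_sub_cancel_left]
  · -- rank two: the basis vectors `e₀`, `e₁` (`0 ≠ 1` in `ℤ/p` since `p ≥ 2`)
    have h01 : (0 : ZMod p) ≠ 1 := by
      haveI : Fact (1 < p) := ⟨(Fact.out : p.Prime).one_lt⟩
      exact zero_ne_one
    refine ⟨SemidirectProduct.inl (Multiplicative.ofAdd (Pi.single 0 (1 : ℤ))), SemidirectProduct.inl (Multiplicative.ofAdd (Pi.single 1 (1 : ℤ))), ?_⟩
    rw [MaxArea.det2]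
    simp only [Pi.sub_apply, hφ0, hφ1, SemidirectProduct.left_inl, SemidirectProduct.one_left, toAdd_ofAdd, toAdd_one, Pi.zero_apply,
      Pi.single_eq_same, Pi.single_eq_of_ne h01, Pi.single_eq_of_ne h01.symm]
    norm_num

end ZWr

end Summit.CriticalPhenomena.PercolationContinuityZ3.Theorems.Transplant

end
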